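import Mathlib.Tactic.DeriveFintype
import Mathlib.Logic.Embedding.Basic
import Mathlib.Algebra.BigOperators.Fin
import Literature.Barriers.ValiantsHypothesis.MonotoneGap
import HarnessLib

/-!
# The inner-product gadget for the directed spanning tree problem (CDGM 2022, §5.1)

Chattopadhyay–Datta–Ghosal–Mukhopadhyay, *Monotone complexity of spanning tree polynomial
re-visited* (ITCS 2022, arXiv:2109.06941), §5.1: a rectangular reduction from the inner product
function `IP_k` to the 2-party spanning tree problem. For `x, y ∈ {0,1}^k` the gadget graph
`G_{x,y}` has Alice's vertices `a_{i,1}, a_{i,2}`, Bob's vertices `b_{i,1}, b_{i,2}`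
(`i ≤ k`), a last sub-gadget `a_{k+1,1}, b_{k+1,1}` and the root `r`; every non-root vertex has
exactly one out-edge ("When `x_i = 0`, `τ_x(a_{i,1}) = a_{i+1,1}` ..."), and **Claim 5.1**: the
oriented edges form a spanning tree rooted at `r` iff `⟨x,y⟩ = 1 mod 2`.

## What is here

* Parent maps `f : V → Option V` (root = `none`): `Reaches f v` (iterating the parent map from
  `v` reaches the root), `IsTree f` (every vertex does); on `Fin N` this is definitionally
  `IsArborescence` of `MonotoneGap.lean` (`isTree_iff_isArborescence`). Transport along an
  injection `e : V ↪ W` with all other vertices attached to the root (`embedMap`, the embedding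
  step of CDGM's sampling process, §5.2) preserves and reflects being a tree
  (`isTree_embedMap_iff`).
* The gadget: vertex type `GV k`, the map `gadget x y : GV k → Option (GV k)`, the prefix
  parities `ipParity`, `ip x y = IP_k(x,y)`, and Claim 5.1 as `isTree_gadget_iff` (proof: rail
  bookkeeping `reaches_a_iff` for the direction `IP = 1`, and the closed cycle `onCycle` through
  `a_{k+1,1} → a_{1,1}` for `IP = 0`).
* For an embedding `e : GV k ↪ W` and Alice's vertex set `A ⊆ W`: honoured sub-gadgets
  (`Honoured`, Def. 5.1) and Remark 5.3 — Alice's view (the map on `A`) does not depend on Bob's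
  bits of honoured sub-gadgets and vice versa (`embedMap_gadget_eq_of_mem`,
  `embedMap_gadget_eq_of_not_mem`); `isArborescence_embedMap_gadget_iff`.

Indexing: sub-gadgets are `i : Fin k` (the paper's `G_{i+1}`), rails are `j : Bool`
(`false` = the paper's index `1`, `true` = index `2`); `fin false = a_{k+1,1}`,
`fin true = b_{k+1,1}`. For `k = 0` (not used) `a_{1,1}` does not exist and `fin false` gets a
loop, which keeps Claim 5.1 true.

## References

* [ChattopadhyayDattaGhosalMukhopadhyay2022] §5.1 (Problem 5.1, the reduction, Claim 5.1),
  §5.2 (sampling process), §5.3 (Def. 5.1, Rem. 5.3).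
* [JerrumSnir1982] §4.5 (directed spanning trees as maps `t` with `t^k(i) = 1`).
-/

noncomputable section

namespace Literature.Barriers.ValiantsHypothesis

universe u v

/-! ### Reaching the root along a parent map -/

section Reach

variable {V : Type u} {W : Type v}

/-- One step of the parent map `f : V → Option V` extended to the root `none` (the root is
fixed). [cite: JerrumSnir1982, §4.5] -/
def parentStep (f : V → Option V) : Option V → Option V := fun o => o.bind f

/-- `Reaches f v`: iterating the parent map from `v` eventually reaches the root `none`
(Jerrum–Snir's condition `∃ k, t^k(i) = 1`). [cite: JerrumSnir1982, §4.5] -/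
def Reaches (f : V → Option V) (v : V) : Prop :=
  ∃ r : ℕ, (parentStep f)^[r] (some v) = none

/-- `f` is an arborescence (every vertex reaches the root). For `V = Fin N` this is literally
`IsArborescence` (`isTree_iff_isArborescence`). [cite: JerrumSnir1982, §4.5] -/
def IsTree (f : V → Option V) : Prop :=
  ∀ v, Reaches f v

/-- On `Fin N` the notion agrees with `IsArborescence` of `MonotoneGap.lean`. [folklore] -/
theorem isTree_iff_isArborescence {N : ℕ} (t : Fin N → Option (Fin N)) :
    IsTree t ↔ IsArborescence t := Iff.rfl

/-- A vertex attached to the root reaches it. [folklore] -/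
theorem reaches_of_eq_none {f : V → Option V} {v : V} (h : f v = none) : Reaches f v :=
  ⟨1, by simp [parentStep, h]⟩

/-- A vertex reaches the root iff its parent does. [folklore] -/
theorem reaches_iff_of_eq_some {f : V → Option V} {v w : V} (h : f v = some w) :
    Reaches f v ↔ Reaches f w := by
  constructor
  · rintro ⟨r, hr⟩
    cases r with
    | zero => simp at hr
    | succ r =>
      refine ⟨r, ?_⟩
      rwa [Function.iterate_succ_apply, parentStep, Option.bind_some, h] at hr
  · rintro ⟨r, hr⟩
    refine ⟨r + 1, ?_⟩
    rw [Function.iterate_succ_apply, parentStep, Option.bind_some, h]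
    exact hr

/-- A set of vertices closed under the parent map never reaches the root. [folklore] -/
theorem not_reaches_of_closed {f : V → Option V} (C : V → Prop)
    (hC : ∀ v, C v → ∃ w, f v = some w ∧ C w) {v : V} (hv : C v) : ¬ Reaches f v := by
  have key : ∀ r : ℕ, ∀ v, C v → ∃ w, (parentStep f)^[r] (some v) = some w ∧ C w := by
    intro r
    induction r with
    | zero => intro v hv; exact ⟨v, rfl, hv⟩
    | succ r ih =>
      intro v hv
      obtain ⟨w, hw, hCw⟩ := hC v hv
      obtain ⟨w', hw', hCw'⟩ := ih w hCw
      refine ⟨w', ?_, hCw'⟩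
      rw [Function.iterate_succ_apply, parentStep, Option.bind_some, hw]
      exact hw'
  rintro ⟨r, hr⟩
  obtain ⟨w, hw, -⟩ := key r v hv
  rw [hw] at hr
  exact Option.some_ne_none w hr

/-- Transport of a parent map along an injection `e : V ↪ W`: the image of `v` points to the
image of its parent, every vertex of `W` outside the image is attached to the root (CDGM §5.2:
"Connect the remaining vertices of `W` ... to `E(r)`"). [cite: ChattopadhyayDattaGhosalMukhopadhyay2022, §5.2 (sampling process for Δ)] -/
def embedMap (e : V ↪ W) (f : V → Option V) (w : W) : Option W :=
  by classical exact if h : ∃ v, e v = w then (f (Classical.choose h)).map e else none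

/-- The transported map on the image. [cite: ChattopadhyayDattaGhosalMukhopadhyay2022, §5.2] -/
theorem embedMap_apply (e : V ↪ W) (f : V → Option V) (v : V) :
    embedMap e f (e v) = (f v).map e := by
  classical
  unfold embedMap
  have h : ∃ v', e v' = e v := ⟨v, rfl⟩
  rw [dif_pos h, e.injective (Classical.choose_spec h)]

/-- The transported map off the image: attached to the root.
[cite: ChattopadhyayDattaGhosalMukhopadhyay2022, §5.2] -/
theorem embedMap_of_not_exists (e : V ↪ W) (f : V → Option V) {w : W} (hw : ¬ ∃ v, e v = w) :
    embedMap e f w = none := by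
  classical
  unfold embedMap
  rw [dif_neg hw]

/-- Iterating the transported map on the image is the image of iterating the map. [folklore] -/
theorem iterate_parentStep_embedMap (e : V ↪ W) (f : V → Option V) (r : ℕ) (o : Option V) :
    (parentStep (embedMap e f))^[r] (o.map e) = ((parentStep f)^[r] o).map e := by
  induction r generalizing o with
  | zero => rfl
  | succ r ih =>
    rw [Function.iterate_succ_apply, Function.iterate_succ_apply, ← ih]
    congr 1
    cases o with
    | none => rfl
    | some v => simp [parentStep, embedMap_apply]

/-- A vertex of the image reaches the root iff its preimage does. [folklore] -/
theorem reaches_embedMap_iff (e : V ↪ W) (f : V → Option V) (v : V) :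
    Reaches (embedMap e f) (e v) ↔ Reaches f v := by
  unfold Reaches
  have h := fun r => iterate_parentStep_embedMap e f r (some v)
  simp only [Option.map_some] at h
  simp_rw [h, Option.map_eq_none_iff]

/-- The transported map is an arborescence iff the original one is.
[cite: ChattopadhyayDattaGhosalMukhopadhyay2022, §5.2 (sampling process for Δ)] -/
theorem isTree_embedMap_iff (e : V ↪ W) (f : V → Option V) :
    IsTree (embedMap e f) ↔ IsTree f := by
  constructor
  · intro h v
    exact (reaches_embedMap_iff e f v).1 (h (e v))
  · intro h w
    by_cases hw : ∃ v, e v = w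
    · obtain ⟨v, rfl⟩ := hw
      exact (reaches_embedMap_iff e f v).2 (h v)
    · exact reaches_of_eq_none (embedMap_of_not_exists e f hw)

end Reach

/-! ### The gadget -/

/-- Vertices of the gadget graph `G_{x,y}` of CDGM §5.1 for `k` bits (the root `r` is the
extra point `none`): Alice's vertices `a i j` (`a_{i+1,1}, a_{i+1,2}` for `j = false, true`),
Bob's vertices `b i j`, and the two vertices of the last sub-gadget, `fin false = a_{k+1,1}`
(Alice) and `fin true = b_{k+1,1}` (Bob). [cite: ChattopadhyayDattaGhosalMukhopadhyay2022, §5.1] -/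
inductive GV (k : ℕ) : Type
  | a (i : Fin k) (j : Bool) : GV k
  | b (i : Fin k) (j : Bool) : GV k
  | fin (j : Bool) : GV k
  deriving DecidableEq, Fintype

variable {k : ℕ}

/-- The next vertex on rail `j` after sub-gadget `i`: `a_{i+2,j}`, or the end `fin j` of the rail
after the last sub-gadget. [cite: ChattopadhyayDattaGhosalMukhopadhyay2022, §5.1] -/
def GV.nxt (i : Fin k) (j : Bool) : GV k :=
  if h : i.val + 1 < k then GV.a ⟨i.val + 1, h⟩ j else GV.fin j

/-- **The gadget map `G_{x,y}`** (CDGM §5.1, the reduction from `IP_k`): "When `x_i = 0`,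
`τ_x(a_{i,1}) = a_{i+1,1}` and `τ_x(a_{i,2}) = a_{i+1,2}`. For `x_i = 1`, `τ_x(a_{i,1}) = b_{i,1}`
and `τ_x(a_{i,2}) = b_{i,2}`. ... when `y_i = 0`, `θ_y(b_{i,1}) = a_{i+1,1}` and
`θ_y(b_{i,2}) = a_{i+1,2}`. When `y_i = 1`, `θ_y(b_{i,1}) = a_{i+1,2}` and `θ_y(b_{i,2}) = a_{i+1,1}`.
In sub-gadget `G_{n+1}`, `τ_x(a_{n+1,1}) = a_{1,1}` and `θ_y(b_{n+1,1}) = r`." (For `k = 0` the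
vertex `fin false` is given a loop.) [cite: ChattopadhyayDattaGhosalMukhopadhyay2022, §5.1] -/
def gadget (x y : Fin k → Bool) : GV k → Option (GV k)
  | .a i j => some (if x i = true then GV.b i j else GV.nxt i j)
  | .b i j => some (GV.nxt i (xor j (y i)))
  | .fin false => if h : 0 < k then some (GV.a ⟨0, h⟩ false) else some (GV.fin false)
  | .fin true => none

/-- Prefix parities of the inner product: `ipParity x y i = Σ_{i' < i} x_{i'} y_{i'} mod 2`.
[cite: ChattopadhyayDattaGhosalMukhopadhyay2022, §5.1 (proof of Claim 5.1)] -/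
def ipParity (x y : Fin k → Bool) : ℕ → Bool
  | 0 => false
  | i + 1 => xor (ipParity x y i) (if h : i < k then x ⟨i, h⟩ && y ⟨i, h⟩ else false)

/-- The inner product `IP_k(x,y) = Σ xᵢyᵢ mod 2` as a Boolean. [cite: ChattopadhyayDattaGhosalMukhopadhyay2022, §2 (IP_m)] -/
def ip (x y : Fin k → Bool) : Bool := ipParity x y k

/-- Suffix parities `Σ_{i ≤ i' < k} x_{i'} y_{i'} mod 2` (the number of rail flips still ahead).
[cite: ChattopadhyayDattaGhosalMukhopadhyay2022, §5.1 (proof of Claim 5.1)] -/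
def ipSuffix (x y : Fin k → Bool) (i : ℕ) : Bool := xor (ipParity x y i) (ip x y)

/-- Recursion for the suffix parities. [folklore] -/
theorem ipSuffix_of_lt (x y : Fin k → Bool) (i : Fin k) :
    ipSuffix x y i.val = xor (x i && y i) (ipSuffix x y (i.val + 1)) := by
  unfold ipSuffix
  rw [show ipParity x y (i.val + 1) = xor (ipParity x y i.val) (x i && y i) by
    simp [ipParity, i.isLt]]
  cases ipParity x y i.val <;> cases (x i && y i) <;> cases ip x y <;> rfl

/-- The suffix parity after the last sub-gadget is `0`. [folklore] -/
@[simp] theorem ipSuffix_self (x y : Fin k → Bool) : ipSuffix x y k = false := by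
  simp [ipSuffix, ip]

/-- The suffix parity at the start is `IP(x,y)`. [folklore] -/
@[simp] theorem ipSuffix_zero (x y : Fin k → Bool) : ipSuffix x y 0 = ip x y := by
  simp [ipSuffix, ipParity]

/-! ### Claim 5.1: `G_{x,y}` is a spanning tree rooted at `r` iff `IP(x,y) = 1` -/

section Claim

variable (x y : Fin k → Bool)

/-- Alice's vertex `a_{i+1,j}` reaches the root iff its successor does. [folklore] -/
theorem reaches_a_iff_succ (i : Fin k) (j : Bool) :
    Reaches (gadget x y) (GV.a i j) ↔
      Reaches (gadget x y) (if x i = true then GV.b i j else GV.nxt i j) :=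
  reaches_iff_of_eq_some (f := gadget x y) rfl

/-- Bob's vertex `b_{i+1,j}` reaches the root iff its successor does. [folklore] -/
theorem reaches_b_iff_succ (i : Fin k) (j : Bool) :
    Reaches (gadget x y) (GV.b i j) ↔ Reaches (gadget x y) (GV.nxt i (xor j (y i))) :=
  reaches_iff_of_eq_some (f := gadget x y) rfl

/-- Rail bookkeeping: from `a_{i+1,j}` one reaches the root iff one does from the end of rail
`j ⊕ (Σ_{i' ≥ i} x_{i'}y_{i'})`. [cite: ChattopadhyayDattaGhosalMukhopadhyay2022, §5.1 (proof of Claim 5.1)] -/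
theorem reaches_a_iff : ∀ (d : ℕ) (i : Fin k) (_ : i.val + d + 1 = k) (j : Bool),
    Reaches (gadget x y) (GV.a i j) ↔
      Reaches (gadget x y) (GV.fin (xor j (ipSuffix x y i.val))) := by
  intro d
  induction d with
  | zero =>
    intro i hi j
    have hs := ipSuffix_of_lt x y i
    simp only [show i.val + 1 = k by omega, ipSuffix_self, Bool.xor_false] at hs
    have hn : ∀ j', GV.nxt i j' = GV.fin j' := by
      intro j'; unfold GV.nxt; rw [dif_neg (by omega)]
    rw [reaches_a_iff_succ]
    cases hx : x i
    · simp only [Bool.false_eq_true, if_false, hn]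
      rw [hs, hx]; simp
    · simp only [if_true]
      rw [reaches_b_iff_succ, hn, hs, hx, Bool.true_and]
  | succ d ih =>
    intro i hi j
    have hs := ipSuffix_of_lt x y i
    let i' : Fin k := ⟨i.val + 1, by omega⟩
    have ih' := ih i' (by simp [i']; omega)
    have hn : ∀ j', GV.nxt i j' = GV.a i' j' := by
      intro j'; unfold GV.nxt; rw [dif_pos (by omega)]
    rw [reaches_a_iff_succ]
    cases hx : x i
    · simp only [Bool.false_eq_true, if_false, hn]
      rw [ih', hs, hx]; simp [i']
    · simp only [if_true]
      rw [reaches_b_iff_succ, hn, ih', hs, hx, Bool.true_and, Bool.xor_assoc]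

/-- If `IP(x,y) = 1` then `G_{x,y}` is a spanning tree rooted at `r`.
[cite: ChattopadhyayDattaGhosalMukhopadhyay2022, §5.1, Claim 5.1] -/
theorem isTree_gadget_of_ip (h : ip x y = true) : IsTree (gadget x y) := by
  have hfin : ∀ j, Reaches (gadget x y) (GV.fin j) := by
    have ht : Reaches (gadget x y) (GV.fin true) := reaches_of_eq_none rfl
    intro j
    cases j
    · by_cases hk : 0 < k
      · rw [reaches_iff_of_eq_some (f := gadget x y) (w := GV.a ⟨0, hk⟩ false)
            (by simp [gadget, hk]),
          reaches_a_iff x y (k - 1) ⟨0, hk⟩ (by simp; omega), ipSuffix_zero, h]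
        exact ht
      · have hk0 : k = 0 := by omega
        subst hk0
        simp [ip, ipParity] at h
    · exact ht
  have ha : ∀ (i : Fin k) (j : Bool), Reaches (gadget x y) (GV.a i j) := by
    intro i j
    exact (reaches_a_iff x y (k - 1 - i.val) i (by omega) j).2 (hfin _)
  intro v
  cases v with
  | a i j => exact ha i j
  | b i j =>
    rw [reaches_b_iff_succ]
    unfold GV.nxt
    split_ifs
    · exact ha _ _
    · exact hfin _
  | fin j => exact hfin j

/-- The cycle when `IP(x,y) = 0`: the vertices on the rails selected by the prefix parities
(together with `a_{k+1,1}`) are mapped into themselves.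
[cite: ChattopadhyayDattaGhosalMukhopadhyay2022, §5.1 (proof of Claim 5.1, the path 𝒫₁)] -/
def onCycle : GV k → Prop
  | .a i j => j = ipParity x y i.val
  | .b i j => x i = true ∧ j = ipParity x y i.val
  | .fin j => j = false

/-- If `IP(x,y) = 0` the cycle is closed under the gadget map.
[cite: ChattopadhyayDattaGhosalMukhopadhyay2022, §5.1 (proof of Claim 5.1)] -/
theorem onCycle_closed (h : ip x y = false) :
    ∀ v, onCycle x y v → ∃ w, gadget x y v = some w ∧ onCycle x y w := by
  have hstep : ∀ i : Fin k, ipParity x y (i.val + 1) = xor (ipParity x y i.val) (x i && y i) := by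
    intro i; simp [ipParity, i.isLt]
  have hlast : ∀ i : Fin k, ¬ i.val + 1 < k → ipParity x y (i.val + 1) = false := by
    intro i hi
    have : i.val + 1 = k := by omega
    rw [this]; exact h
  intro v hv
  cases v with
  | a i j =>
    change j = ipParity x y i.val at hv
    refine ⟨_, rfl, ?_⟩
    cases hx : x i
    · simp only [Bool.false_eq_true, if_false]
      unfold GV.nxt
      split_ifs with hi
      · change j = ipParity x y (i.val + 1)
        rw [hstep, hx, hv]; simp
      · change j = false
        rw [hv, ← hlast i hi, hstep, hx]; simp
    · exact ⟨hx, hv⟩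
  | b i j =>
    obtain ⟨hx, hj⟩ := hv
    refine ⟨_, rfl, ?_⟩
    unfold GV.nxt
    split_ifs with hi
    · change xor j (y i) = ipParity x y (i.val + 1)
      rw [hstep, hx, hj, Bool.true_and]
    · change xor j (y i) = false
      rw [← hlast i hi, hstep, hx, hj, Bool.true_and]
  | fin j =>
    change j = false at hv
    subst hv
    by_cases hk : 0 < k
    · exact ⟨GV.a ⟨0, hk⟩ false, by simp [gadget, hk], by simp [onCycle, ipParity]⟩
    · exact ⟨GV.fin false, by simp [gadget, hk], rfl⟩

/-- **Claim 5.1** (CDGM §5.1): the oriented edges of `G_{x,y}` form a spanning tree rooted at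
`r` if and only if `⟨x,y⟩ = 1 mod 2`. [cite: ChattopadhyayDattaGhosalMukhopadhyay2022, §5.1, Claim 5.1] -/
theorem isTree_gadget_iff : IsTree (gadget x y) ↔ ip x y = true := by
  refine ⟨fun h => ?_, isTree_gadget_of_ip x y⟩
  by_contra hip
  rw [Bool.not_eq_true] at hip
  exact not_reaches_of_closed (onCycle x y) (onCycle_closed x y hip) (v := GV.fin false) rfl
    (h (GV.fin false))

end Claim

/-! ### The embedded gadget: honoured sub-gadgets and the players' views -/

section Views

variable {W : Type v} (e : GV k ↪ W) (A : Finset W)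

/-- Sub-gadget `i` is *honoured* by the embedding `e` with respect to Alice's vertex set `A`:
Alice's two vertices of `G_i` land in `A` and Bob's two vertices land outside `A`
(CDGM Def. 5.1). [cite: ChattopadhyayDattaGhosalMukhopadhyay2022, §5.3, Def. 5.1] -/
def Honoured (i : Fin k) : Prop :=
  e (GV.a i false) ∈ A ∧ e (GV.a i true) ∈ A ∧ e (GV.b i false) ∉ A ∧ e (GV.b i true) ∉ A

/-- **Alice's view does not depend on Bob's honoured bits** (CDGM Rem. 5.3): on `A`, the
embedded gadget map is unchanged when `y` is modified on honoured sub-gadgets.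
[cite: ChattopadhyayDattaGhosalMukhopadhyay2022, §5.3, Rem. 5.3] -/
theorem embedMap_gadget_eq_of_mem {x y y' : Fin k → Bool}
    (hy : ∀ i, ¬ Honoured e A i → y i = y' i) {w : W} (hw : w ∈ A) :
    embedMap e (gadget x y) w = embedMap e (gadget x y') w := by
  by_cases h : ∃ v, e v = w
  · obtain ⟨v, rfl⟩ := h
    rw [embedMap_apply, embedMap_apply]
    cases v with
    | a i j => rfl
    | b i j =>
      by_cases hi : Honoured e A i
      · cases j
        · exact absurd hw hi.2.2.1
        · exact absurd hw hi.2.2.2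
      · simp [gadget, hy i hi]
    | fin j => cases j <;> rfl
  · rw [embedMap_of_not_exists e _ h, embedMap_of_not_exists e _ h]

/-- **Bob's view does not depend on Alice's honoured bits** (CDGM Rem. 5.3): off `A`, the
embedded gadget map is unchanged when `x` is modified on honoured sub-gadgets.
[cite: ChattopadhyayDattaGhosalMukhopadhyay2022, §5.3, Rem. 5.3] -/
theorem embedMap_gadget_eq_of_not_mem {x x' y : Fin k → Bool}
    (hx : ∀ i, ¬ Honoured e A i → x i = x' i) {w : W} (hw : w ∉ A) :
    embedMap e (gadget x y) w = embedMap e (gadget x' y) w := by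
  by_cases h : ∃ v, e v = w
  · obtain ⟨v, rfl⟩ := h
    rw [embedMap_apply, embedMap_apply]
    cases v with
    | a i j =>
      by_cases hi : Honoured e A i
      · cases j
        · exact absurd hi.1 hw
        · exact absurd hi.2.1 hw
      · simp [gadget, hx i hi]
    | b i j => rfl
    | fin j => cases j <;> rfl
  · rw [embedMap_of_not_exists e _ h, embedMap_of_not_exists e _ h]

/-- The embedded gadget map on `Fin N` (the maps `ν` in the support of CDGM's universal
distribution `Δ`) is an arborescence iff `IP(x,y) = 1`.
[cite: ChattopadhyayDattaGhosalMukhopadhyay2022, §5.1 (Claim 5.1) and §5.2] -/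
theorem isArborescence_embedMap_gadget_iff {N : ℕ} (e : GV k ↪ Fin N) (x y : Fin k → Bool) :
    IsArborescence (embedMap e (gadget x y)) ↔ ip x y = true := by
  rw [← isTree_iff_isArborescence, isTree_embedMap_iff, isTree_gadget_iff]

end Views

end Literature.Barriers.ValiantsHypothesis
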